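import Literature.NumberTheory.GaloisRepresentations.BrauerLayerBound
import Literature.NumberTheory.GaloisRepresentations.PGroupDescent
import Literature.NumberTheory.GaloisRepresentations.KummerTwo
import HarnessLib

/-!
# The bound `|Br(L/E)| ≤ [L : E]` along a tower (Serre, *Corps locaux* XIII §3–4)

For a field `k` of characteristic zero satisfying the norm index equality
`(Kˣ : N_{L/K} Lˣ) = [L : K]` for the finite cyclic Galois extensions `L/K` of its finite
extensions `K` (the `H⁰` part of the class field axiom — Neukirch V (1.1) for local fields), a
finite Galois `L₁/k` inside `k̄` and subgroups `D' ⊴ D ≤ Gal(L₁/k)` with fixed fields `E ⊆ E'`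
(`E'/E` Galois), we prove that the relative Brauer group
`Br(E'/E) = ker(res : H²(Gal(k̄/E), k̄ˣ) → H²(Gal(k̄/E'), k̄ˣ))` is finite of order at most
`(D : D') = [E' : E]`:

* `Literature.NumberTheory.GaloisRepresentations.resSub_self`, `resKer_eq_bot_of_le` — `res` along
  `S ≤ S` is the identity, so `ker(res)` is trivial when `T = S`;
* `Literature.NumberTheory.GaloisRepresentations.liftSub` — the subgroups between `D'` and `D`
  attached to the subgroups of `D/D'`;
* `Literature.NumberTheory.GaloisRepresentations.natCard_resKer_le_of_isPGroup` — the case of a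
  `p`-subgroup `P̄ ≤ D/D'`: induction along a cyclic series (`IsPGroup.subgroup_induction`) using
  the layer bound `natCard_resKer_layer_le` and the multiplicativity `natCard_resKer_le_mul`;
* `Literature.NumberTheory.GaloisRepresentations.natCard_resKer_le_relIndex` — the general case:
  `Br(E'/E) → Π_p Br(E'/E_p)` (`E_p` the fixed field of the preimage `D_p` of a Sylow `p`-subgroup
  of `D/D'`) is injective, because a class in the kernel is killed by every index `(D : D_p)`
  (`Cor ∘ Res`, `index_smul_eq_zero_of_resH_eq_zero`) and by `(D : D')`, hence has order `1`; so
  `|Br(E'/E)| ≤ Π_p |D_p/D'| = (D : D')`; `natCard_resKer_bot_le` is the case `D' = 1`,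
  `|Br(L₁/E)| ≤ [L₁ : E]`.

## References
* J.-P. Serre, *Corps locaux*, Hermann, 1968, XIII §3 (Prop. 7, 8) and §4 (lemmas on `H²` of
  finite groups via Sylow subgroups). [SerreLocalFields1979]
* J. W. S. Cassels, A. Fröhlich (eds.), *Algebraic Number Theory*, 1967, Ch. VI §1.6–1.7.
* J. Neukirch, *Algebraic Number Theory*, Springer, 1999, Ch. V §1 Thm. (1.1). [NeukirchANT1999]
-/

noncomputable section

open CategoryTheory Function

universe u

namespace Literature.NumberTheory.GaloisRepresentations

open _root_.TopRep _root_.ContRepresentation _root_.ContinuousCohomology DiscreteGaloisModule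
open _root_.Field _root_.IntermediateField LocalWeilDatum

/-! ### `res` along `S ≤ S` is the identity -/

section General

variable {G : Type u} [Group G] [TopologicalSpace G] [IsTopologicalGroup G]
variable {A : Type u} [AddCommGroup A] [TopologicalSpace A] [DiscreteTopology A]

/-- The map on cohomology induced by a pair which is pointwise the identity is the identity.
[folklore] -/
theorem map_apply_of_id {T : Type u} [Group T] [TopologicalSpace T] [IsTopologicalGroup T]
    {X : TopRep.{u} ℤ T} (φ : T →ₜ* T) (hφ : ∀ x, φ x = x) (f : TopRep.res (φ : T →* T) X ⟶ X)
    (hf : ∀ v, f.hom v = v) (n : ℕ) (z : continuousCohomology n X) :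
    ContinuousCohomology.map φ f n z = z := by
  obtain rfl : φ = ContinuousMonoidHom.id T := ContinuousMonoidHom.ext hφ
  rw [map_id_eq_id f hf n]
  rfl

/-- **`res : Hⁿ(S, A) → Hⁿ(S, A)` along `S ≤ S` is the identity.** [folklore] -/
theorem resSub_self (ρ : ContinuousRep G ℤ A) (S : Subgroup G) (n : ℕ)
    (z : continuousCohomology n (ρ.restrict (subgroupIncl S)).toTopRep) :
    resSub ρ (le_refl S) n z = z :=
  map_apply_of_id (inclHom (le_refl S)) (fun _ => rfl) (resSubMod ρ (le_refl S)) (fun _ => rfl) n z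

/-- **`ker(res_{S→T}) = 0` when `S ≤ T`** (then `res_{T→S} ∘ res_{S→T} = id`). [folklore] -/
theorem resKer_eq_bot_of_le (ρ : ContinuousRep G ℤ A) {T S : Subgroup G} (h : T ≤ S) (h' : S ≤ T) :
    resKer ρ h = ⊥ := by
  rw [eq_bot_iff]
  intro z hz
  rw [mem_resKer] at hz
  rw [AddSubgroup.mem_bot, ← resSub_self ρ S 2 z, ← resSub_resSub ρ h' h 2 z, hz, map_zero]

/-- `resSub ρ (h : T ≤ S) n z = 0` only depends on the subgroup `T`. [folklore] -/
theorem resSub_eq_zero_congr (ρ : ContinuousRep G ℤ A) {T₁ T₂ S : Subgroup G} (e : T₁ = T₂)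
    (h₁ : T₁ ≤ S) (h₂ : T₂ ≤ S) (n : ℕ)
    (z : continuousCohomology n (ρ.restrict (subgroupIncl S)).toTopRep) :
    resSub ρ h₁ n z = 0 ↔ resSub ρ h₂ n z = 0 := by
  subst e
  rfl

/-- **An element killed by `m` and by `m / p^{v_p(m)}` for every prime `p ∣ m` is zero** (its
order divides `m` and is prime to every prime factor of `m`). [folklore] -/
theorem eq_zero_of_ordCompl_nsmul_eq_zero {M : Type*} [AddCommGroup M] {m : ℕ} (hm : m ≠ 0)
    (x : M) (hx : m • x = 0) (hp : ∀ p ∈ m.primeFactors, (m / p ^ m.factorization p) • x = 0) :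
    x = 0 := by
  by_contra hx0
  have ho : addOrderOf x ≠ 1 := by
    rwa [Ne, AddMonoid.addOrderOf_eq_one_iff]
  obtain ⟨q, hq, hqo⟩ := Nat.exists_prime_and_dvd ho
  have hom : addOrderOf x ∣ m := addOrderOf_dvd_of_nsmul_eq_zero hx
  have hqm : q ∈ m.primeFactors := Nat.mem_primeFactors.2 ⟨hq, hqo.trans hom, hm⟩
  have h2 : addOrderOf x ∣ m / q ^ m.factorization q := addOrderOf_dvd_of_nsmul_eq_zero (hp q hqm)
  exact Nat.not_dvd_ordCompl hq hm (hqo.trans h2)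

end General

/-! ### Subgroups between `D'` and `D` from subgroups of `D/D'` -/

section LiftSub

/-- Normality passes along `Subgroup.comap`, relative version. [folklore] -/
theorem normal_subgroupOf_comap {G G' : Type*} [Group G] [Group G'] (f : G →* G')
    {C C' : Subgroup G'} (hn : (C'.subgroupOf C).Normal) :
    ((C'.comap f).subgroupOf (C.comap f)).Normal := by
  refine ⟨fun x hx y => ?_⟩
  rw [Subgroup.mem_subgroupOf, Subgroup.mem_comap] at hx ⊢
  have h := hn.conj_mem ⟨f x, Subgroup.mem_comap.1 x.2⟩ hx ⟨f y, Subgroup.mem_comap.1 y.2⟩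
  rw [Subgroup.mem_subgroupOf] at h
  simpa only [Subgroup.coe_mul, Subgroup.coe_inv, map_mul, map_inv] using h

variable {Γ : Type*} [Group Γ] {D D' : Subgroup Γ}

variable (D D') in
/-- The subgroup `D' ≤ C ≤ D` attached to `C̄ ≤ D/D'` (preimage in `D`, viewed in `Γ`). [folklore] -/
def liftSub [(D'.subgroupOf D).Normal] (C : Subgroup (D ⧸ D'.subgroupOf D)) : Subgroup Γ :=
  (C.comap (QuotientGroup.mk' (D'.subgroupOf D))).map D.subtype

variable [(D'.subgroupOf D).Normal]

/-- `D' ≤ liftSub C̄`. [folklore] -/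
theorem le_liftSub (hDD : D' ≤ D) (C : Subgroup (D ⧸ D'.subgroupOf D)) : D' ≤ liftSub D D' C := by
  intro x hx
  refine Subgroup.mem_map.2 ⟨⟨x, hDD hx⟩, ?_, rfl⟩
  rw [Subgroup.mem_comap, QuotientGroup.mk'_apply,
    (QuotientGroup.eq_one_iff (⟨x, hDD hx⟩ : D)).2 (by exact hx)]
  exact C.one_mem

/-- `liftSub C̄ ≤ D`. [folklore] -/
theorem liftSub_le (C : Subgroup (D ⧸ D'.subgroupOf D)) : liftSub D D' C ≤ D :=
  Subgroup.map_subtype_le _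

/-- `liftSub` is monotone. [folklore] -/
theorem liftSub_mono {C C' : Subgroup (D ⧸ D'.subgroupOf D)} (h : C' ≤ C) :
    liftSub D D' C' ≤ liftSub D D' C :=
  Subgroup.map_mono (Subgroup.comap_mono h)

/-- `liftSub ⊥ = D'`. [folklore] -/
theorem liftSub_bot (hDD : D' ≤ D) : liftSub D D' ⊥ = D' := by
  rw [liftSub, MonoidHom.comap_bot, QuotientGroup.ker_mk']
  exact Subgroup.map_subgroupOf_eq_of_le hDD

/-- `liftSub ⊤ = D`. [folklore] -/
theorem liftSub_top : liftSub D D' ⊤ = D := by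
  rw [liftSub, Subgroup.comap_top, ← MonoidHom.range_eq_map, Subgroup.range_subtype]

/-- Normality of layers passes to `liftSub`. [folklore] -/
theorem normal_liftSub {C C' : Subgroup (D ⧸ D'.subgroupOf D)} (h : C' ≤ C)
    (hn : (C'.subgroupOf C).Normal) :
    ((liftSub D D' C').subgroupOf (liftSub D D' C)).Normal :=
  normal_subgroupOf_map D.subtype (Subgroup.comap_mono h) (normal_subgroupOf_comap _ hn)

/-- `liftSub` preserves relative indices. [folklore] -/
theorem relIndex_liftSub (C C' : Subgroup (D ⧸ D'.subgroupOf D)) :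
    (liftSub D D' C').relIndex (liftSub D D' C) = C'.relIndex C := by
  rw [liftSub, liftSub, Subgroup.relIndex_map_map_of_injective _ _ D.subtype_injective,
    Subgroup.relIndex_comap,
    Subgroup.map_comap_eq_self_of_surjective (QuotientGroup.mk'_surjective _)]

/-- The index of `liftSub C̄` in `D` is the index of `C̄` in `D/D'`. [folklore] -/
theorem relIndex_liftSub_eq_index (C : Subgroup (D ⧸ D'.subgroupOf D)) :
    (liftSub D D' C).relIndex D = C.index := by
  have h := relIndex_liftSub (D := D) (D' := D') ⊤ C
  rw [liftSub_top, Subgroup.relIndex_top_right] at h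
  exact h

end LiftSub

/-! ### The tower over a field -/

section Tower

variable {k : Type u} [Field k]
variable (L₁ : IntermediateField k (AlgebraicClosure k)) [FiniteDimensional k L₁] [IsGalois k L₁]

/-- **The index of `N ∩ N'` in `N` is `(D : D')`.** [folklore] -/
theorem index_layerN'_subgroupOf (D D' : Subgroup (L₁ ≃ₐ[k] L₁)) :
    ((layerN' L₁ D').subgroupOf (layerN L₁ D)).index = D'.relIndex D := by
  change (layerN' L₁ D').relIndex (layerN L₁ D) = _
  have h := relIndex_galFixing_lift_fixedField L₁ D' D
  rwa [galFixing_lift_fixedField, galFixing_lift_fixedField] at h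

/-- `N ∩ N'` is open in `N`. [folklore] -/
theorem isOpen_layerN'_subgroupOf (D D' : Subgroup (L₁ ≃ₐ[k] L₁)) :
    IsOpen (((layerN' L₁ D').subgroupOf (layerN L₁ D) : Subgroup (layerN L₁ D)) :
      Set (layerN L₁ D)) := by
  haveI : FiniteDimensional k (lift (fixedField D')) :=
    (liftAlgEquiv (fixedField D')).toLinearEquiv.finiteDimensional
  change IsOpen ((Subtype.val : layerN L₁ D → absoluteGaloisGroup k) ⁻¹' (layerN' L₁ D'))
  refine IsOpen.preimage continuous_subtype_val ?_
  rw [show (layerN' L₁ D' : Set (absoluteGaloisGroup k)) = galFixing k (lift (fixedField D')) by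
    rw [galFixing_lift_fixedField]]
  exact isOpen_galFixing k _

/-- `N = Gal(k̄/E)` is closed in `Γ_k`. [folklore] -/
theorem isClosed_layerN (D : Subgroup (L₁ ≃ₐ[k] L₁)) :
    IsClosed ((layerN L₁ D : Subgroup (absoluteGaloisGroup k)) : Set (absoluteGaloisGroup k)) := by
  rw [layerN_eq_galFixing]
  exact isClosed_galFixing k _

/-- **`(D : D') · z = 0` for `z ∈ ker(res : H²(N_D) → H²(N_{D'}))`, `D' ≤ D`** (`Cor ∘ Res`).
[cite: SerreGaloisCohomology1997, I §2.4 Prop. 9] -/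
theorem relIndex_nsmul_eq_zero_of_mem_resKer [CharZero k] {D D' : Subgroup (L₁ ≃ₐ[k] L₁)}
    (hDD : D' ≤ D) (z : continuousCohomology 2 (layerRep L₁ D).toTopRep)
    (hz : z ∈ resKer (units k) (layerN'_le L₁ hDD)) : D'.relIndex D • z = 0 := by
  haveI : IsClosed ((layerN L₁ D : Subgroup (absoluteGaloisGroup k)) :
    Set (absoluteGaloisGroup k)) := isClosed_layerN L₁ D
  have hmap : ((layerN' L₁ D').subgroupOf (layerN L₁ D)).map (layerN L₁ D).subtype = layerN' L₁ D' :=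
    Subgroup.map_subgroupOf_eq_of_le (layerN'_le L₁ hDD)
  rw [mem_resKer, ← resSub_eq_zero_congr (units k) hmap (map_subtype_le' _) (layerN'_le L₁ hDD),
    resSub_eq_zero_iff_resH_eq_zero] at hz
  rw [← index_layerN'_subgroupOf L₁ D D']
  exact index_smul_eq_zero_of_resH_eq_zero (layerRep L₁ D) _ (isOpen_layerN'_subgroupOf L₁ D D') z hz

variable [CharZero k]
variable (hNI : ∀ (K L : Type u) [Field K] [Field L] [Algebra k K] [Algebra K L]
  [FiniteDimensional k K] [FiniteDimensional K L] [IsGalois K L] [IsCyclic (L ≃ₐ[K] L)],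
  (Units.map (Algebra.norm K (S := L) : L →* K)).range.index = Module.finrank K L)

include hNI in
/-- **The `p`-group case**: for `D' ⊴ D ≤ Gal(L₁/k)` (fixed fields `E ⊆ E'`) and a `p`-subgroup
`P̄ ≤ D/D'` with preimage `D_P` (fixed field `E_P ⊆ E'`),
`Br(E'/E_P) = ker(H²(Gal(k̄/E_P), k̄ˣ) → H²(Gal(k̄/E'), k̄ˣ))` is finite of order `≤ |P̄|`: induction
along a cyclic series of `P̄` (`IsPGroup.subgroup_induction`), each layer contributing a factor
`≤ p` (`natCard_resKer_layer_le`, `natCard_resKer_le_mul`).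
[cite: SerreLocalFields1979, XIII §4] -/
theorem natCard_resKer_le_of_isPGroup {D D' : Subgroup (L₁ ≃ₐ[k] L₁)} (hDD : D' ≤ D)
    [(D'.subgroupOf D).Normal] {p : ℕ} [hp : Fact p.Prime]
    (P : Subgroup (D ⧸ D'.subgroupOf D)) (hP : IsPGroup p P) :
    Finite (resKer (units k) (Subgroup.comap_mono (le_liftSub hDD P) :
      layerN' L₁ D' ≤ layerN L₁ (liftSub D D' P))) ∧
      Nat.card (resKer (units k) (Subgroup.comap_mono (le_liftSub hDD P) :
        layerN' L₁ D' ≤ layerN L₁ (liftSub D D' P))) ≤ Nat.card P := by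
  classical
  -- the statement for the subgroups `C ≤ P`, viewed in `Gal(L₁/k)`
  let Φ : Subgroup P → Prop := fun C =>
    Finite (resKer (units k) (Subgroup.comap_mono (le_liftSub hDD (C.map P.subtype)) :
      layerN' L₁ D' ≤ layerN L₁ (liftSub D D' (C.map P.subtype)))) ∧
      Nat.card (resKer (units k) (Subgroup.comap_mono (le_liftSub hDD (C.map P.subtype)) :
        layerN' L₁ D' ≤ layerN L₁ (liftSub D D' (C.map P.subtype)))) ≤ Nat.card C
  have hΦ : Φ ⊤ := by
    apply IsPGroup.subgroup_induction hP Φ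
    · -- `C = ⊥`: the kernel of `res` along `Γ_{E'} ≤ Γ_{E'}` is trivial
      have hle : layerN L₁ (liftSub D D' ((⊥ : Subgroup P).map P.subtype)) ≤ layerN' L₁ D' := by
        refine Subgroup.comap_mono ?_
        rw [Subgroup.map_bot, liftSub_bot hDD]
      have hbot := (AddSubgroup.eq_bot_iff_forall _).1 (resKer_eq_bot_of_le (units k)
        (Subgroup.comap_mono (le_liftSub hDD ((⊥ : Subgroup P).map P.subtype)) :
          layerN' L₁ D' ≤ layerN L₁ (liftSub D D' ((⊥ : Subgroup P).map P.subtype))) hle)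
      have hsub : Subsingleton (resKer (units k)
          (Subgroup.comap_mono (le_liftSub hDD ((⊥ : Subgroup P).map P.subtype)) :
            layerN' L₁ D' ≤ layerN L₁ (liftSub D D' ((⊥ : Subgroup P).map P.subtype)))) :=
        ⟨fun a b => Subtype.ext ((hbot a.1 a.2).trans (hbot b.1 b.2).symm)⟩
      haveI := hsub
      exact ⟨Finite.of_subsingleton, (Nat.card_of_subsingleton (0 : resKer (units k)
          (Subgroup.comap_mono (le_liftSub hDD ((⊥ : Subgroup P).map P.subtype)) :
            layerN' L₁ D' ≤ layerN L₁ (liftSub D D' ((⊥ : Subgroup P).map P.subtype))))).le.trans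
        (Nat.succ_le_of_lt Nat.card_pos)⟩
    · -- the layer `C' ⊲ C` of index `p`
      intro C C' hC'C hnorm hidx hΦC'
      obtain ⟨hfin', hcard'⟩ := hΦC'
      have hCC : C'.map P.subtype ≤ C.map P.subtype := Subgroup.map_mono hC'C
      have hDDC : liftSub D D' (C'.map P.subtype) ≤ liftSub D D' (C.map P.subtype) :=
        liftSub_mono hCC
      have hn : ((liftSub D D' (C'.map P.subtype)).subgroupOf
          (liftSub D D' (C.map P.subtype))).Normal :=
        normal_liftSub hCC (normal_subgroupOf_map P.subtype hC'C hnorm)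
      have hindex : (liftSub D D' (C'.map P.subtype)).relIndex
          (liftSub D D' (C.map P.subtype)) = p := by
        rw [relIndex_liftSub, Subgroup.relIndex_map_map_of_injective _ _ P.subtype_injective]
        exact hidx
      obtain ⟨hfinL, hcardL⟩ := natCard_resKer_layer_le L₁ hDDC hn hNI hindex
      haveI := hfin'
      haveI := hfinL
      obtain ⟨hfin, hcard⟩ := natCard_resKer_le_mul (units k)
        (Subgroup.comap_mono (le_liftSub hDD (C'.map P.subtype)) :
          layerN' L₁ D' ≤ layerN L₁ (liftSub D D' (C'.map P.subtype)))
        (layerN'_le L₁ hDDC)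
      refine ⟨hfin, hcard.trans ((Nat.mul_le_mul hcardL hcard').trans_eq ?_)⟩
      -- `p · |C'| = |C|`
      rw [← hidx, Subgroup.relIndex, ← Nat.card_congr (Subgroup.subgroupOfEquivOfLe hC'C).toEquiv,
        mul_comm, Subgroup.card_mul_index]
  -- `⊤.map P.subtype = P`
  have htop : (⊤ : Subgroup P).map P.subtype = P := by
    rw [← MonoidHom.range_eq_map, Subgroup.range_subtype]
  obtain ⟨hfin, hcard⟩ := hΦ
  replace hcard := hcard.trans_eq Subgroup.card_top
  have key : ∀ (X : Subgroup (D ⧸ D'.subgroupOf D)), X = P →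
      Finite (resKer (units k) (Subgroup.comap_mono (le_liftSub hDD X) :
        layerN' L₁ D' ≤ layerN L₁ (liftSub D D' X))) →
      Nat.card (resKer (units k) (Subgroup.comap_mono (le_liftSub hDD X) :
        layerN' L₁ D' ≤ layerN L₁ (liftSub D D' X))) ≤ Nat.card P →
      Finite (resKer (units k) (Subgroup.comap_mono (le_liftSub hDD P) :
        layerN' L₁ D' ≤ layerN L₁ (liftSub D D' P))) ∧
        Nat.card (resKer (units k) (Subgroup.comap_mono (le_liftSub hDD P) :
          layerN' L₁ D' ≤ layerN L₁ (liftSub D D' P))) ≤ Nat.card P := by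
    rintro X rfl h₁ h₂
    exact ⟨h₁, h₂⟩
  exact key _ htop hfin hcard

include hNI in
/-- **The bound `|Br(E'/E)| ≤ [E' : E]`**: for `D' ⊴ D ≤ Gal(L₁/k)` with fixed fields `E ⊆ E'`,
`ker(res : H²(Gal(k̄/E), k̄ˣ) → H²(Gal(k̄/E'), k̄ˣ))` is finite of order at most `(D : D')`.  With
`D_p` the preimage of a Sylow `p`-subgroup of `D/D'` (fixed field `E_p`) for each prime
`p ∣ (D : D')`, the map `Br(E'/E) → Π_p Br(E'/E_p)` is injective: a class `z` in its kernel
satisfies `(D : D') · z = 0` and `(D : D_p) · z = 0` for all `p`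
(`relIndex_nsmul_eq_zero_of_mem_resKer`), so `z = 0` (`eq_zero_of_ordCompl_nsmul_eq_zero`); and
`|Br(E'/E_p)| ≤ |D_p/D'|` (`natCard_resKer_le_of_isPGroup`), `Π_p |D_p/D'| = (D : D')`.
[cite: SerreLocalFields1979, XIII §4 (Lemme 2, Prop. 9)] -/
theorem natCard_resKer_le_relIndex {D D' : Subgroup (L₁ ≃ₐ[k] L₁)} (hDD : D' ≤ D)
    (hn : (D'.subgroupOf D).Normal) :
    Finite (resKer (units k) (layerN'_le L₁ hDD)) ∧
      Nat.card (resKer (units k) (layerN'_le L₁ hDD)) ≤ D'.relIndex D := by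
  classical
  haveI := hn
  set m : ℕ := D'.relIndex D with hm
  have hmQ : Nat.card (D ⧸ D'.subgroupOf D) = m := rfl
  have hm0 : m ≠ 0 := by
    rw [← hmQ]
    exact Nat.card_pos.ne'
  -- preimages `Q p` of the Sylow subgroups of `D/D'` and their kernels
  let P : ∀ p : m.primeFactors, Sylow (p : ℕ) (D ⧸ D'.subgroupOf D) := fun _ => default
  let Q : m.primeFactors → Subgroup (L₁ ≃ₐ[k] L₁) := fun p =>
    liftSub D D' (P p : Subgroup (D ⧸ D'.subgroupOf D))
  have hQD : ∀ p, Q p ≤ D := fun p => liftSub_le _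
  have hD'Q : ∀ p, D' ≤ Q p := fun p => le_liftSub hDD _
  have hprime : ∀ p : m.primeFactors, Fact (p : ℕ).Prime := fun p =>
    ⟨Nat.prime_of_mem_primeFactors p.2⟩
  have hPcard : ∀ p, Nat.card (P p) = (p : ℕ) ^ m.factorization p := fun p => by
    haveI := hprime p
    rw [(P p).card_eq_multiplicity, hmQ]
  have hQindex : ∀ p, (Q p).relIndex D = m / (p : ℕ) ^ m.factorization p := fun p => by
    haveI := hprime p
    change (liftSub D D' _).relIndex D = _
    rw [relIndex_liftSub_eq_index]
    refine (Nat.div_eq_of_eq_mul_right (pow_pos (hprime p).out.pos _) ?_).symm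
    rw [← hPcard, Subgroup.card_mul_index, hmQ]
  have hK : ∀ p, Finite (resKer (units k) (Subgroup.comap_mono (hD'Q p) :
      layerN' L₁ D' ≤ layerN L₁ (Q p))) ∧
      Nat.card (resKer (units k) (Subgroup.comap_mono (hD'Q p) :
        layerN' L₁ D' ≤ layerN L₁ (Q p))) ≤ (p : ℕ) ^ m.factorization p := fun p => by
    haveI := hprime p
    obtain ⟨h1, h2⟩ := natCard_resKer_le_of_isPGroup L₁ hNI hDD
      (P p : Subgroup (D ⧸ D'.subgroupOf D)) (P p).isPGroup'
    exact ⟨h1, h2.trans_eq (hPcard p)⟩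
  -- the map `Br(E'/E) → Π_p Br(E'/E_p)`
  let K₀ := resKer (units k) (layerN'_le L₁ hDD)
  let Kp := fun p : m.primeFactors => resKer (units k) (Subgroup.comap_mono (hD'Q p) :
    layerN' L₁ D' ≤ layerN L₁ (Q p))
  have hmemp : ∀ (p) (z : K₀), resSub (units k) (Subgroup.comap_mono (hQD p) :
      layerN L₁ (Q p) ≤ layerN L₁ D) 2 z.1 ∈ Kp p := fun p z => by
    rw [mem_resKer, resSub_resSub]
    exact (mem_resKer _ _ _).1 z.2
  let Ψ : K₀ → ∀ p : m.primeFactors, Kp p := fun z p => ⟨_, hmemp p z⟩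
  -- a class killed by all `res_{Q p}` is zero
  have hzero : ∀ z : K₀, (∀ p, resSub (units k) (Subgroup.comap_mono (hQD p) :
      layerN L₁ (Q p) ≤ layerN L₁ D) 2 z.1 = 0) → z = 0 := by
    intro z hz
    apply Subtype.ext
    refine eq_zero_of_ordCompl_nsmul_eq_zero hm0 z.1 ?_ ?_
    · exact relIndex_nsmul_eq_zero_of_mem_resKer L₁ hDD z.1 z.2
    · intro p hp
      have h := relIndex_nsmul_eq_zero_of_mem_resKer L₁ (hQD ⟨p, hp⟩) z.1
        ((mem_resKer _ _ _).2 (hz ⟨p, hp⟩))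
      rwa [hQindex ⟨p, hp⟩] at h
  have hΨ : Injective Ψ := by
    intro z₁ z₂ h
    rw [← sub_eq_zero]
    refine hzero _ fun p => ?_
    have hp : (Ψ z₁ p).1 = (Ψ z₂ p).1 := by rw [h]
    change resSub (units k) _ 2 (z₁.1 - z₂.1) = 0
    rw [map_sub, sub_eq_zero]
    exact hp
  -- counting
  haveI : ∀ p, Finite (Kp p) := fun p => (hK p).1
  haveI : Finite (∀ p : m.primeFactors, Kp p) := Pi.finite
  refine ⟨Finite.of_injective Ψ hΨ, ?_⟩
  calc Nat.card K₀ ≤ Nat.card (∀ p : m.primeFactors, Kp p) := Nat.card_le_card_of_injective Ψ hΨ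
    _ = ∏ p : m.primeFactors, Nat.card (Kp p) := Nat.card_pi
    _ ≤ ∏ p : m.primeFactors, (p : ℕ) ^ m.factorization p :=
        Finset.prod_le_prod (fun p _ => Nat.zero_le _) fun p _ => (hK p).2
    _ = m := (Nat.prod_primeFactors_coe_pow_factorization hm0).symm

include hNI in
/-- **The bound `|Br(L₁/E)| ≤ [L₁ : E]`**: for `D ≤ Gal(L₁/k)` with fixed field `E`,
`ker(res : H²(Gal(k̄/E), k̄ˣ) → H²(Gal(k̄/L₁), k̄ˣ))` is finite of order at most `|D|`
(`natCard_resKer_le_relIndex` with `D' = 1`). [cite: SerreLocalFields1979, XIII §4 Prop. 9] -/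
theorem natCard_resKer_bot_le (D : Subgroup (L₁ ≃ₐ[k] L₁)) :
    Finite (resKer (units k) (layerN'_le L₁ (bot_le : (⊥ : Subgroup (L₁ ≃ₐ[k] L₁)) ≤ D))) ∧
      Nat.card (resKer (units k) (layerN'_le L₁ (bot_le : (⊥ : Subgroup (L₁ ≃ₐ[k] L₁)) ≤ D))) ≤
        Nat.card D := by
  rw [← Subgroup.relIndex_bot_left (H := D)]
  exact natCard_resKer_le_relIndex L₁ hNI bot_le inferInstance

end Tower

end Literature.NumberTheory.GaloisRepresentations

end
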